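import Summits.Ventures.PercRepro.S2ThirteenSixSpreadThree
import Summits.Ventures.PercRepro.S1CoreCapSpreadChainRows

/-!
# PercRepro — S2: THE CELL `(13, 6)` (p7, gen 16; sub-claim S2; the first cell of the row `p = 13`)

**`c025_core_five_thirteen_six`**: `RLS M 13 5` for every `e`-free core of rank `13` on `19` points — the cell `(13, 6)` modulo
the one cap (`c025_core_five_thirteen_six_of_cap`, p7 g16) composed with p1 g33's spread cap `s₄ ≤ 30` on the coloop-free spread
core (`S1.ncard_fourCircuits_le_thirty_spread_nineteen`, S1CoreCapSpreadChainRows). Nothing beyond the cell is claimed: the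
window of record is the lead's, and the row `p = 13` needs the cells `(13, 7 … 12)` besides. Axioms: standard.
-/

open scoped Matroid

namespace PercRepro

namespace ThmN

open Set

variable {α : Type}

/-- **THE CELL `(13, 6)`**: `RLS M 13 5` on every `e`-free core of rank `13` on `19` points. -/
theorem c025_core_five_thirteen_six (M : Matroid α) [M.Finite]
    (hR : M.eRank = ((13 : ℕ) : ℕ∞)) (hn : M.E.ncard = 13 + 6)
    (hfree : ∀ e ∈ M.E, ∃ A ⊆ M.E \ {e}, e ∉ M.closure A ∧ e ∉ M.closure ((M.E \ {e}) \ A)) : RLS M 13 5 := by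
  refine c025_core_five_thirteen_six_of_cap (fun M' _ hR' hn' hfree' hK' h4' => ?_) M hR hn hfree
  have hd : M'.E.encard = M'.eRank + 6 := by
    rw [hR', ← M'.ground_finite.cast_ncard_eq, hn']
    push_cast
    ring
  exact S1.ncard_fourCircuits_le_thirty_spread_nineteen M' hfree' h4' hd hn' hK'

end ThmN

end PercRepro
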